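import Literature.NumberTheory.EllipticCurves.BDPAnticyclotomicPAdicLFunction
import Literature.NumberTheory.EllipticCurves.UnrIntegersUnits
import Summits.BirchSwinnertonDyer.Rank1Residual.X11b.HalvesReceptacle
import Summits.BirchSwinnertonDyer.Rank1Residual.X11b.UnrIntegersTeichmuller
import HarnessLib

/-!
# `μ = 0` and `λ` as the FIRST UNIT COEFFICIENT in `Λ_{R₀} = R₀⟦T⟧`, and the algebra of MEMO-1 L9:
# one divisibility after inverting `p` + equal `μ = 0`, `λ` ⟹ equal ideals; `𝓕(0) = u·𝓛(0)` read in `ℚ_p`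
# (cell `bsd-eis`, `run/shared/lean/pub/bsd-eis/`; seat `bsd-eis-ky` gen 5; THEOREMS ONLY;
# companion of `X1/KellerYinIMC2Halves.lean`)

HONEST FRAMING (FULL-BSD rank-≤1 programme D-0033, row A1 = class X1 ∩ {`r_an = 1`, type A}, 7 892
census cells). Pure algebra of the receptacle `R₀⟦T⟧` of the BDP `p`-adic `L`-function
(`UnrSeries p`, `R₀ = unrIntegers p ⊂ ℂ_p` the completed ring of integers of `ℚ_p^ur`), used by
`X1/KellerYinIMC2Halves.lean` to prove that the four typed links inside Keller–Yin Thm. 3.0.8 at `𝟙`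
(`h308`, the one preprint input of THEOREM A) imply `h308`. Everything here is PROVED (Mathlib + the
tree's `R₀` API of class X11b: `unrIntegers.isUnit_iff_norm_eq_one`, `X11b.R1.div_p_mem_unrIntegers`,
`X11b.Halves.toUnr`); nothing about any curve is asserted; nothing booked.

* the hypothesis shape "`μ(L) = 0` and `λ(L) = n`" (inline, no definition): the first coefficient of
  `L ∈ R₀⟦T⟧` of norm `1` (a unit of `R₀`) sits at index `n` (Weierstrass preparation over the complete DVR `R₀ = W(𝔽̄_p)`,
  Washington Prop. 7.2; for `ℤ_p⟦T⟧` the tree's `X1.MuLambda.mu` / `lam`).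
* `firstUnitCoeffAt_mul` (Gauss's lemma: indices add), `exists_firstUnitCoeffAt_right`,
  `exists_mul_eq_of_mul_eq_C_pow_mul` (`F` with a unit coefficient and `F·G = p^k·L` ⟹ `F·G' = L`:
  `p ∣ G` coefficientwise, `k` times), `span_singleton_eq_of_firstUnitCoeffAt` (same index for `F` and
  `L = F·G'` ⟹ `G'` is a unit ⟹ `(F) = (L)`), `span_singleton_eq_of_C_pow_mul_mem` (MEMO-1 L9:
  `p^k·L ∈ (F)`, `μ = 0`, `λ` equal ⟹ `(F) = (L)`), `exists_unit_constantCoeff_eq` ([CGLS] (5.4) read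
  back in `ℚ_p`: `(map F) = (L)`, `L(𝟙) = w·V`, `w ∈ R₀ˣ`, `V ∈ ℚ_p` ⟹ `F(0) = u·V`, `u ∈ ℤ_pˣ`).

References: [Washington1997] §7.1 Prop. 7.2, §13.2; [CastellaGrossiLeeSkinner2022] proof of
Thm. 5.3.1, display (5.4); HOME/bsd-eis-ky-MEMO-1.md §2 L9.
-/

set_option autoImplicit false

noncomputable section

open scoped Classical

open PowerSeries Literature.NumberTheory.EllipticCurves
  Summit.BirchSwinnertonDyer.Rank1Residual.X11b.Halves
open Literature.NumberTheory.LFunctions.Dwork (norm_natCast_p_padicComplex)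

namespace Summit.BirchSwinnertonDyer.Rank1Residual.X1.KellerYinHalves

variable {p : ℕ} [Fact p.Prime]

/-! ### "`μ(L) = 0` and `λ(L) = n`" for `L ∈ Λ_{R₀} = R₀⟦T⟧`, coefficientwise

Throughout, the HYPOTHESIS SHAPE `‖[Tⁿ]L‖ = 1 ∧ ∀ i < n, ‖[Tⁱ]L‖ < 1` (coefficients read in `ℂ_p`) says:
the first coefficient of `L` that is a UNIT of `R₀` (`‖·‖ = 1`, `unrIntegers.isUnit_iff_norm_eq_one`)
sits at index `n`. By the `p`-adic Weierstrass preparation theorem over the complete discrete valuation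
ring `R₀ = W(𝔽̄_p)` (`L = p^{μ} · D · U`, `D` distinguished, `U` a unit) this is exactly `μ(L) = 0` and
`deg D = λ(L) = n` (Washington, Prop. 7.2 / §7.1; for `Λ = ℤ_p⟦T⟧` compare the tree's
`X1.MuLambda.mu`, `X1.MuLambda.lam`). It is spelled out INLINE in every statement (no new definition,
no notation), written `FU(L, n)` in the docstrings below. -/

/-- A finite sum of elements of `ℂ_p` of norm `< 1` has norm `< 1`. [folklore] -/
private theorem norm_sum_lt_one {α : Type*} (s : Finset α) {g : α → ℂ_[p]}
    (h : ∀ a ∈ s, ‖g a‖ < 1) : ‖∑ a ∈ s, g a‖ < 1 := by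
  induction s using Finset.induction_on with
  | empty => rw [Finset.sum_empty, norm_zero]; exact one_pos
  | insert a s ha ih =>
    rw [Finset.sum_insert ha]
    exact (IsUltrametricDist.norm_add_le_max _ _).trans_lt
      (max_lt (h a (Finset.mem_insert_self a s)) (ih fun b hb => h b (Finset.mem_insert_of_mem hb)))

/-- The `n`-th coefficient of a product in `R₀⟦T⟧`, read in `ℂ_p`. [folklore] -/
theorem coe_coeff_mul (F G : UnrSeries p) (n : ℕ) :
    ((coeff n (F * G) : unrIntegers p) : ℂ_[p]) =
      ∑ x ∈ Finset.HasAntidiagonal.antidiagonal n,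
        ((coeff x.1 F : unrIntegers p) : ℂ_[p]) * ((coeff x.2 G : unrIntegers p) : ℂ_[p]) := by
  rw [PowerSeries.coeff_mul]
  push_cast
  rfl

/-- Every coefficient of `L ∈ R₀⟦T⟧` has norm `≤ 1`. [folklore] -/
theorem norm_coeff_le_one (L : UnrSeries p) (n : ℕ) :
    ‖((coeff n L : unrIntegers p) : ℂ_[p])‖ ≤ 1 :=
  norm_coe_unrIntegers_le_one p _

/-- If all coefficients of `G` of index `≤ m` have norm `< 1`, so does the `m`-th coefficient of
`F · G`. [folklore] -/
theorem norm_coeff_mul_lt_one_of_forall_lt {F G : UnrSeries p} {m : ℕ}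
    (hG : ∀ j ≤ m, ‖((coeff j G : unrIntegers p) : ℂ_[p])‖ < 1) :
    ‖((coeff m (F * G) : unrIntegers p) : ℂ_[p])‖ < 1 := by
  rw [coe_coeff_mul]
  refine norm_sum_lt_one _ fun x hx ↦ ?_
  rw [Finset.HasAntidiagonal.mem_antidiagonal] at hx
  rw [norm_mul]
  calc ‖((coeff x.1 F : unrIntegers p) : ℂ_[p])‖ * ‖((coeff x.2 G : unrIntegers p) : ℂ_[p])‖
      ≤ ‖((coeff x.2 G : unrIntegers p) : ℂ_[p])‖ := by
        have h1 := mul_le_mul_of_nonneg_right (norm_coeff_le_one F x.1)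
          (norm_nonneg ((coeff x.2 G : unrIntegers p) : ℂ_[p]))
        rwa [one_mul] at h1
    _ < 1 := hG x.2 (by omega)

/-- **Gauss's lemma for the first unit coefficient**: if the first unit coefficient of `F` sits at
`a` and that of `G` at `b`, then that of `F · G` sits at `a + b`. [cite: Washington1997, §7.1] -/
theorem firstUnitCoeffAt_mul {F G : UnrSeries p} {a b : ℕ} (hF : (‖((coeff a F : unrIntegers p) : ℂ_[p])‖ = 1 ∧
      ∀ i < a, ‖((coeff i F : unrIntegers p) : ℂ_[p])‖ < 1)) (hG : (‖((coeff b G : unrIntegers p) : ℂ_[p])‖ = 1 ∧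
      ∀ i < b, ‖((coeff i G : unrIntegers p) : ℂ_[p])‖ < 1)) :
    (‖((coeff (a + b) (F * G) : unrIntegers p) : ℂ_[p])‖ = 1 ∧
      ∀ i < a + b, ‖((coeff i (F * G) : unrIntegers p) : ℂ_[p])‖ < 1) := by
  -- a term `F_i G_j` with `i + j = m` has norm `< 1` unless `i ≥ a` and `j ≥ b`
  have hterm : ∀ i j : ℕ, i < a ∨ j < b →
      ‖((coeff i F : unrIntegers p) : ℂ_[p]) * ((coeff j G : unrIntegers p) : ℂ_[p])‖ < 1 := by
    intro i j hij
    rw [norm_mul]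
    rcases hij with hi | hj
    · calc ‖((coeff i F : unrIntegers p) : ℂ_[p])‖ * ‖((coeff j G : unrIntegers p) : ℂ_[p])‖
          ≤ ‖((coeff i F : unrIntegers p) : ℂ_[p])‖ := by
            have h1 := mul_le_mul_of_nonneg_left (norm_coeff_le_one G j)
              (norm_nonneg ((coeff i F : unrIntegers p) : ℂ_[p]))
            rwa [mul_one] at h1
        _ < 1 := hF.2 i hi
    · calc ‖((coeff i F : unrIntegers p) : ℂ_[p])‖ * ‖((coeff j G : unrIntegers p) : ℂ_[p])‖
          ≤ ‖((coeff j G : unrIntegers p) : ℂ_[p])‖ := by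
            have h1 := mul_le_mul_of_nonneg_right (norm_coeff_le_one F i)
              (norm_nonneg ((coeff j G : unrIntegers p) : ℂ_[p]))
            rwa [one_mul] at h1
        _ < 1 := hG.2 j hj
  refine ⟨?_, fun m hm ↦ ?_⟩
  · -- the coefficient at `a + b`: one term of norm `1`, the others of norm `< 1`
    rw [coe_coeff_mul, ← Finset.add_sum_erase _ _ (Finset.HasAntidiagonal.mem_antidiagonal.mpr rfl : (a, b) ∈ _)]
    have hmain : ‖((coeff a F : unrIntegers p) : ℂ_[p]) * ((coeff b G : unrIntegers p) : ℂ_[p])‖ = 1 := by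
      rw [norm_mul, hF.1, hG.1, one_mul]
    have hrest : ‖∑ x ∈ (Finset.HasAntidiagonal.antidiagonal (a + b)).erase (a, b),
        ((coeff x.1 F : unrIntegers p) : ℂ_[p]) * ((coeff x.2 G : unrIntegers p) : ℂ_[p])‖ < 1 := by
      refine norm_sum_lt_one _ fun x hx ↦ hterm x.1 x.2 ?_
      obtain ⟨hne, hx⟩ := Finset.mem_erase.mp hx
      rw [Finset.HasAntidiagonal.mem_antidiagonal] at hx
      by_contra hc
      push Not at hc
      exact hne (Prod.ext (by simp only; omega) (by simp only; omega))
    rw [IsUltrametricDist.norm_add_eq_max_of_norm_ne_norm (by rw [hmain]; exact hrest.ne'), hmain,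
      max_eq_left hrest.le]
  · rw [coe_coeff_mul]
    refine norm_sum_lt_one _ fun x hx ↦ hterm x.1 x.2 ?_
    rw [Finset.HasAntidiagonal.mem_antidiagonal] at hx
    by_contra hc
    push Not at hc
    omega

/-- The first unit coefficient index is well defined. [folklore] -/
theorem firstUnitCoeff_unique {L : UnrSeries p} {m n : ℕ} (hm : (‖((coeff m L : unrIntegers p) : ℂ_[p])‖ = 1 ∧
      ∀ i < m, ‖((coeff i L : unrIntegers p) : ℂ_[p])‖ < 1))
    (hn : (‖((coeff n L : unrIntegers p) : ℂ_[p])‖ = 1 ∧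
      ∀ i < n, ‖((coeff i L : unrIntegers p) : ℂ_[p])‖ < 1)) : m = n := by
  by_contra h
  rcases Nat.lt_or_gt_of_ne h with h | h
  · exact (hn.2 m h).ne hm.1
  · exact (hm.2 n h).ne hn.1

/-- If the coefficients of `G` are not all of norm `< 1` up to index `N`, `G` has a first unit
coefficient at some index `≤ N`. [folklore] -/
theorem exists_firstUnitCoeffAt_of_exists_le {G : UnrSeries p} {N : ℕ}
    (h : ∃ j ≤ N, ¬ ‖((coeff j G : unrIntegers p) : ℂ_[p])‖ < 1) :
    ∃ b ≤ N, (‖((coeff b G : unrIntegers p) : ℂ_[p])‖ = 1 ∧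
      ∀ i < b, ‖((coeff i G : unrIntegers p) : ℂ_[p])‖ < 1) := by
  obtain ⟨j, hjN, hj⟩ := h
  have hex : ∃ b, ¬ ‖((coeff b G : unrIntegers p) : ℂ_[p])‖ < 1 := ⟨j, hj⟩
  refine ⟨Nat.find hex, (Nat.find_min' hex hj).trans hjN, ?_, fun i hi ↦ ?_⟩
  · exact le_antisymm (norm_coeff_le_one G _) (not_lt.mp (Nat.find_spec hex))
  · exact not_not.mp (Nat.find_min hex hi)

/-- If `F` has its first unit coefficient at `a` and `F · G` has one at `n`, then `G` has one at
some `b` with `a + b = n`. [cite: Washington1997, §7.1] -/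
theorem exists_firstUnitCoeffAt_right {F G : UnrSeries p} {a n : ℕ}
    (hF : (‖((coeff a F : unrIntegers p) : ℂ_[p])‖ = 1 ∧
      ∀ i < a, ‖((coeff i F : unrIntegers p) : ℂ_[p])‖ < 1))
    (hFG : (‖((coeff n (F * G) : unrIntegers p) : ℂ_[p])‖ = 1 ∧
      ∀ i < n, ‖((coeff i (F * G) : unrIntegers p) : ℂ_[p])‖ < 1))
    : ∃ b, (‖((coeff b G : unrIntegers p) : ℂ_[p])‖ = 1 ∧
      ∀ i < b, ‖((coeff i G : unrIntegers p) : ℂ_[p])‖ < 1) ∧ a + b = n := by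
  have h : ∃ j ≤ n, ¬ ‖((coeff j G : unrIntegers p) : ℂ_[p])‖ < 1 := by
    by_contra hc
    push Not at hc
    exact (norm_coeff_mul_lt_one_of_forall_lt (F := F) hc).ne hFG.1
  obtain ⟨b, -, hb⟩ := exists_firstUnitCoeffAt_of_exists_le h
  exact ⟨b, hb, firstUnitCoeff_unique (firstUnitCoeffAt_mul hF hb) hFG⟩

/-- Division of a power series with all coefficients in `p R₀` by `p` (`R₀` is a discrete
valuation ring with uniformiser `p`: `‖y‖ < 1 ⇒ y/p ∈ R₀`, the tree's `X11b.R1.div_p_mem_unrIntegers`).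
[folklore] -/
theorem exists_eq_C_mul_of_forall_norm_lt_one {G : UnrSeries p}
    (hG : ∀ j, ‖((coeff j G : unrIntegers p) : ℂ_[p])‖ < 1) :
    ∃ G₁ : UnrSeries p, G = C ((p : unrIntegers p)) * G₁ := by
  refine ⟨PowerSeries.mk fun j ↦ ⟨((coeff j G : unrIntegers p) : ℂ_[p]) / p,
    X11b.R1.div_p_mem_unrIntegers (coeff j G).2 (hG j)⟩, ?_⟩
  ext j
  rw [PowerSeries.coeff_C_mul, PowerSeries.coeff_mk]
  push_cast
  have hp0 : (p : ℂ_[p]) ≠ 0 := by exact_mod_cast (Fact.out : p.Prime).ne_zero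
  field_simp

/-- **Cancelling the power of `p`**: if `F` has a unit coefficient and `F · G = p^k · L` in `R₀⟦T⟧`,
then `F · G' = L` for some `G'` (compare coefficients modulo the maximal ideal of `R₀`: `F̄ ≠ 0` and
`𝔽̄_p⟦T⟧` is a domain, so `p ∣ G` whenever `k ≥ 1`). [cite: Washington1997, §7.1] -/
theorem exists_mul_eq_of_mul_eq_C_pow_mul {F G L : UnrSeries p} {a k : ℕ}
    (hF : (‖((coeff a F : unrIntegers p) : ℂ_[p])‖ = 1 ∧
      ∀ i < a, ‖((coeff i F : unrIntegers p) : ℂ_[p])‖ < 1))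
    (h : F * G = C ((p : unrIntegers p) ^ k) * L) : ∃ G' : UnrSeries p, F * G' = L := by
  induction k generalizing G with
  | zero => exact ⟨G, by rw [h, pow_zero, map_one, one_mul]⟩
  | succ k ih =>
    -- every coefficient of `G` has norm `< 1`
    have hG : ∀ j, ‖((coeff j G : unrIntegers p) : ℂ_[p])‖ < 1 := by
      by_contra hc
      push Not at hc
      obtain ⟨j, hj⟩ := hc
      obtain ⟨b, -, hb⟩ := exists_firstUnitCoeffAt_of_exists_le (G := G) ⟨j, le_rfl, not_lt.mpr hj⟩
      have h1 := (firstUnitCoeffAt_mul hF hb).1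
      rw [h, PowerSeries.coeff_C_mul, Subring.coe_mul, norm_mul] at h1
      have hp1 : ‖(((p : unrIntegers p) ^ (k + 1) : unrIntegers p) : ℂ_[p])‖ < 1 := by
        push_cast
        rw [norm_pow, norm_natCast_p_padicComplex]
        exact pow_lt_one₀ (by positivity) (inv_lt_one_of_one_lt₀ (by exact_mod_cast (Fact.out : p.Prime).one_lt))
          (Nat.succ_ne_zero k)
      have hle := mul_le_mul_of_nonneg_left (norm_coeff_le_one L (a + b)) (norm_nonneg
        ((((p : unrIntegers p) ^ (k + 1) : unrIntegers p) : ℂ_[p])))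
      rw [h1, mul_one] at hle
      exact absurd hle (not_le.mpr hp1)
    obtain ⟨G₁, rfl⟩ := exists_eq_C_mul_of_forall_norm_lt_one hG
    refine ih (G := G₁) ?_
    have hp0 : (C (p : unrIntegers p) : UnrSeries p) ≠ 0 := by
      intro h0
      have := congrArg constantCoeff h0
      simp only [map_zero, constantCoeff_C] at this
      exact (Fact.out : p.Prime).ne_zero (by exact_mod_cast congrArg (fun x : unrIntegers p ↦ (x : ℂ_[p])) this)
    apply mul_left_cancel₀ hp0
    calc C (p : unrIntegers p) * (F * G₁) = F * (C (p : unrIntegers p) * G₁) := by ring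
      _ = C ((p : unrIntegers p) ^ (k + 1)) * L := h
      _ = C (p : unrIntegers p) * (C ((p : unrIntegers p) ^ k) * L) := by
          rw [pow_succ, map_mul]; ring

/-- **Unit cofactor** (MEMO-1 L9, second half): if `F` and `L = F · G'` have their first unit
coefficient at the SAME index, the cofactor `G'` has a unit constant term, hence is a unit of `R₀⟦T⟧`,
and `(F) = (L)`. [cite: Washington1997, §7.1] -/
theorem span_singleton_eq_of_firstUnitCoeffAt {F G' L : UnrSeries p} {n : ℕ}
    (hF : (‖((coeff n F : unrIntegers p) : ℂ_[p])‖ = 1 ∧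
      ∀ i < n, ‖((coeff i F : unrIntegers p) : ℂ_[p])‖ < 1))
    (hL : (‖((coeff n L : unrIntegers p) : ℂ_[p])‖ = 1 ∧
      ∀ i < n, ‖((coeff i L : unrIntegers p) : ℂ_[p])‖ < 1)) (h : F * G' = L) :
    Ideal.span ({F} : Set (UnrSeries p)) = Ideal.span {L} := by
  obtain ⟨b, hb, hab⟩ := exists_firstUnitCoeffAt_right hF (h ▸ hL : (‖((coeff n (F * G') : unrIntegers p) : ℂ_[p])‖ = 1 ∧
      ∀ i < n, ‖((coeff i (F * G') : unrIntegers p) : ℂ_[p])‖ < 1))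
  obtain rfl : b = 0 := by omega
  have hunit : IsUnit G' := by
    rw [PowerSeries.isUnit_iff_constantCoeff, unrIntegers.isUnit_iff_norm_eq_one,
      ← coeff_zero_eq_constantCoeff_apply]
    exact hb.1
  rw [← h, Ideal.span_singleton_mul_right_unit hunit]

/-- **MEMO-1 L9 in the kernel**: ONE divisibility after inverting `p` (`p^k · L ∈ (F)`), plus
`μ = 0` and `λ`-equality on both sides (first unit coefficients at the same index), give the
EQUALITY of ideals `(F) = (L)` in `R₀⟦T⟧`. [cite: Washington1997, §7.1] -/
theorem span_singleton_eq_of_C_pow_mul_mem {F L : UnrSeries p} {k n : ℕ}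
    (hdiv : C ((p : unrIntegers p) ^ k) * L ∈ Ideal.span ({F} : Set (UnrSeries p)))
    (hF : (‖((coeff n F : unrIntegers p) : ℂ_[p])‖ = 1 ∧
      ∀ i < n, ‖((coeff i F : unrIntegers p) : ℂ_[p])‖ < 1)) (hL : (‖((coeff n L : unrIntegers p) : ℂ_[p])‖ = 1 ∧
      ∀ i < n, ‖((coeff i L : unrIntegers p) : ℂ_[p])‖ < 1)) :
    Ideal.span ({F} : Set (UnrSeries p)) = Ideal.span {L} := by
  obtain ⟨G, hG⟩ := Ideal.mem_span_singleton'.mp hdiv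
  obtain ⟨G', hG'⟩ := exists_mul_eq_of_mul_eq_C_pow_mul hF (by rw [← hG, mul_comm])
  exact span_singleton_eq_of_firstUnitCoeffAt hF hL hG'

/-- The constant term of `map φ F` is `φ` of the constant term. [folklore] -/
theorem constantCoeff_map_toUnr (F : IwasawaAlgebra p) :
    constantCoeff (PowerSeries.map (toUnr p) F) = toUnr p (constantCoeff F) := by
  rw [← coeff_zero_eq_constantCoeff_apply, coeff_map, coeff_zero_eq_constantCoeff_apply]

/-- **Reading `𝓕(0) = u · 𝓛(0)` back in `ℚ_p`** ([CGLS] (5.4)): if the image of `F ∈ Λ = ℤ_p⟦T⟧`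
generates `(L)` in `R₀⟦T⟧` and `L(𝟙) = w · V` with `w ∈ R₀ˣ`, `V ∈ ℚ_p`, then `F(0) = u · V` for a
unit `u ∈ ℤ_pˣ` (`F(0)·v(0) = w·V` with `v` a unit of `R₀⟦T⟧`; norms in `ℂ_p` give `‖F(0)‖ = ‖V‖`,
and `ℚ_p ∩ {‖·‖ = 1} = ℤ_pˣ`; if `V = 0` then `F(0) = 0` and `u := 1`).
[cite: CastellaGrossiLeeSkinner2022, proof of Thm. 5.3.1 display (5.4)] -/
theorem exists_unit_constantCoeff_eq {F : IwasawaAlgebra p} {L : UnrSeries p}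
    (hFL : Ideal.span ({PowerSeries.map (toUnr p) F} : Set (UnrSeries p)) = Ideal.span {L})
    (w : (unrIntegers p)ˣ) {V : ℚ_[p]}
    (hL : L.HasValueAt 0 (((w : unrIntegers p) : ℂ_[p]) * algebraMap ℚ_[p] ℂ_[p] V)) :
    ∃ u : ℤ_[p]ˣ, ((constantCoeff F : ℤ_[p]) : ℚ_[p]) = ((u : ℤ_[p]) : ℚ_[p]) * V := by
  -- `L(0) = w · V`
  have hL0 : ((w : unrIntegers p) : ℂ_[p]) * algebraMap ℚ_[p] ℂ_[p] V =
      ((constantCoeff L : unrIntegers p) : ℂ_[p]) :=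
    UnrSeries.eq_constantCoeff_of_hasValueAt_zero hL
  -- `map F · v = L` with `v` a unit of `R₀⟦T⟧`
  obtain ⟨v, hv⟩ := Ideal.span_singleton_eq_span_singleton.mp hFL
  have hc1 : ‖((constantCoeff (v : UnrSeries p) : unrIntegers p) : ℂ_[p])‖ = 1 :=
    (unrIntegers.isUnit_iff_norm_eq_one _).mp (PowerSeries.isUnit_constantCoeff _ v.isUnit)
  have hkey : algebraMap ℚ_[p] ℂ_[p] ((constantCoeff F : ℤ_[p]) : ℚ_[p]) *
      ((constantCoeff (v : UnrSeries p) : unrIntegers p) : ℂ_[p]) =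
      ((w : unrIntegers p) : ℂ_[p]) * algebraMap ℚ_[p] ℂ_[p] V := by
    rw [hL0, ← hv, map_mul, Subring.coe_mul, constantCoeff_map_toUnr, coe_toUnr]
  -- norms: `‖F(0)‖ = ‖V‖`
  have hnorm : ‖((constantCoeff F : ℤ_[p]) : ℚ_[p])‖ = ‖V‖ := by
    have h := congrArg (‖·‖) hkey
    simp only [norm_mul, hc1, mul_one, norm_coe_units_unrIntegers, one_mul, norm_algebraMap'] at h
    exact h
  by_cases hV : V = 0
  · refine ⟨1, ?_⟩
    rw [hV, mul_zero]
    rw [hV, norm_zero, norm_eq_zero] at hnorm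
    exact hnorm
  · -- `u₀ := F(0)/V ∈ ℚ_p` has norm `1`, hence is a unit of `ℤ_p`
    set u₀ : ℚ_[p] := ((constantCoeff F : ℤ_[p]) : ℚ_[p]) / V with hu₀
    have hu₀1 : ‖u₀‖ = 1 := by
      rw [hu₀, norm_div, hnorm, div_self (norm_ne_zero_iff.mpr hV)]
    refine ⟨PadicInt.mkUnits hu₀1, ?_⟩
    rw [PadicInt.mkUnits_eq, hu₀, div_mul_cancel₀ _ hV]

end Summit.BirchSwinnertonDyer.Rank1Residual.X1.KellerYinHalves

end
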